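import Mathlib

/-!
# Separation of the rational primes in a finite Euler-product identity — the second half of the
# algebraic kernel of the L-function line for the ramified clause of `StrongLiftingAllFinite`
# (item stmt-Langlands-15194, route `SkinnerWilesDefectOne`)

Companion of `SkinnerWilesDefectOneStrongLiftingAllFiniteLFactorRigidity` (the single-prime
rigidity).  Comparing the functional equations of `Λ(s, P)` and `∏_{i mod ℓ} Λ(s, π ⊗ ηⁱ)`
(Godement–Jacquet) leaves a FINITE Euler-product identity over the bad rational primes,

  `∏_{p ∈ S} Φ_p(p^{-s}) = C · ∏_{p ∈ S} Ψ_p(p^{-s})`     (`re s ≫ 0`),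

with `Φ_p`, `Ψ_p` rational functions (products over the places above `p` of local `L`-polynomials,
their duals reflected through `s ↦ 1 - s`, and conductor powers `p^{e s}`); cleared of denominators
it is a POLYNOMIAL identity of the same shape.  THIS FILE proves that such an identity, assumed only
at the integers `s = k ≥ k₀`, separates prime by prime (pure algebra, no automorphic input):

* `eq_zero_of_sum_mul_pow_eq_zero_of_le` — **independence of geometric progressions**: if
  `∑_x c_x r_x^k = 0` for all `k ≥ k₀` with the `r_x` pairwise distinct and non-zero, then every
  `c_x = 0` (Vandermonde, Mathlib `Matrix.eq_zero_of_forall_pow_sum_mul_pow_eq_zero`).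
* `prod_prime_pow_injective` — **unique factorisation**: `e ↦ ∏_i p_i^{e_i}` is injective for
  pairwise distinct primes `p_i`.
* `prime_separation` — **separation**: if `∏_i φ_i(p_i^{-k}) = C ∏_i ψ_i(p_i^{-k})` for all `k ≥ k₀`,
  with `φ_i, ψ_i ∈ ℂ[X]` non-zero and the `p_i` pairwise distinct primes, then `φ_i = c_i ψ_i` with
  `c_i ≠ 0` and `∏ c_i = C` — expand the products (`Finset.prod_univ_sum`), group by the radius
  `∏ p_i^{e_i}` (injective in `e`), apply the independence, and separate the resulting rank-one
  identity `∏_i a_i(e_i) = C ∏_i b_i(e_i)` of coefficient tensors coordinate by coordinate.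

For `F = ℚ` (the instance the route consumes) every finite place is its own rational prime, so
`prime_separation` isolates the ramified prime `p₀` directly and hands the single-prime identity to
`blocks_trivial_of_prod_eq_smul`; over a general `F` the places above one rational prime share the
variable `X = p^{-s}` and are separated by auxiliary twists instead (not treated here).

## References

* R. Godement, H. Jacquet, *Zeta functions of simple algebras*, LNM 260 (1972), Thm. 13.8 and
  Thm. 3.3 (local factors are inverse polynomials in `q^{-s}`). [GodementJacquet1972]
* J. Arthur, L. Clozel, Ann. of Math. Stud. 120 (1989), Ch. 3, Thm. 5.1. [ArthurClozelAMS120]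
-/

set_option linter.dupNamespace false -- project-wide option (lakefile weak.linter.dupNamespace); `Summit.Langlands.Langlands` is the mandated namespace

open Polynomial Finset

namespace Summit.Langlands.Langlands.Theorems.SkinnerWilesDefectOne.StrongLiftingAllFinite

/-! ### Independence of geometric progressions -/

/-- **Geometric progressions with distinct non-zero ratios are linearly independent, also along a
tail `k ≥ k₀`.**  If `∑_x c_x r_x^k = 0` for every `k ≥ k₀`, `r` injective and nowhere zero, then
`c = 0`: the `card κ` equations at `k = k₀, …, k₀ + card κ - 1` form a Vandermonde system in the
unknowns `c_x r_x^{k₀}`. [folklore] -/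
theorem eq_zero_of_sum_mul_pow_eq_zero_of_le {κ : Type*} [Fintype κ] (r c : κ → ℂ)
    (hr : Function.Injective r) (hr0 : ∀ x, r x ≠ 0) (k₀ : ℕ)
    (h : ∀ k, k₀ ≤ k → ∑ x, c x * r x ^ k = 0) : c = 0 := by
  classical
  set n := Fintype.card κ
  set e : κ ≃ Fin n := Fintype.equivFin κ
  set f : Fin n → ℂ := fun j => r (e.symm j) with hf
  set v : Fin n → ℂ := fun j => c (e.symm j) * r (e.symm j) ^ k₀ with hv
  have hfi : Function.Injective f := hr.comp e.symm.injective
  have hv0 : v = 0 := by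
    apply Matrix.eq_zero_of_forall_pow_sum_mul_pow_eq_zero hfi
    intro i
    have h1 := h (k₀ + i) (Nat.le_add_right _ _)
    rw [← Equiv.sum_comp e.symm (fun x => c x * r x ^ (k₀ + (i : ℕ)))] at h1
    rw [← h1]
    refine Finset.sum_congr rfl fun j _ => ?_
    simp only [hf, hv, pow_add, mul_assoc]
  funext x
  have hx := congrFun hv0 (e x)
  simp only [hv, Pi.zero_apply, Equiv.symm_apply_apply] at hx
  exact (mul_eq_zero.mp hx).resolve_right (pow_ne_zero _ (hr0 x))

/-! ### Unique factorisation for a family of distinct primes -/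

/-- The exponent of `p_j` in `∏_i p_i^{e_i}` is `e_j` (the `p_i` pairwise distinct primes).
[folklore] -/
theorem factorization_prod_prime_pow {ι : Type*} [Fintype ι] (p : ι → ℕ) (hp : ∀ i, (p i).Prime)
    (hinj : Function.Injective p) (e : ι → ℕ) (j : ι) :
    (∏ i, p i ^ e i).factorization (p j) = e j := by
  classical
  rw [Nat.factorization_prod fun i _ => pow_ne_zero _ (hp i).ne_zero, Finsupp.finsetSum_apply,
    Finset.sum_eq_single j]
  · rw [(hp j).factorization_pow, Finsupp.single_eq_same]
  · intro i _ hij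
    rw [(hp i).factorization_pow, Finsupp.single_apply, if_neg (hinj.ne hij)]
  · intro hj
    exact absurd (Finset.mem_univ j) hj

/-- **`e ↦ ∏_i p_i^{e_i}` is injective** for pairwise distinct primes `p_i` (unique factorisation).
[folklore] -/
theorem prod_prime_pow_injective {ι : Type*} [Fintype ι] (p : ι → ℕ) (hp : ∀ i, (p i).Prime)
    (hinj : Function.Injective p) :
    Function.Injective fun e : ι → ℕ => ∏ i, p i ^ e i := by
  intro e e' h
  funext j
  have h1 := congrArg (fun n : ℕ => n.factorization (p j)) h
  simpa only [factorization_prod_prime_pow p hp hinj] using h1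

/-! ### Separation of the primes -/

/-- **Prime separation.**  Let `p_i` (`i ∈ ι`) be pairwise distinct primes, `φ_i, ψ_i ∈ ℂ[X]`
non-zero, `C ∈ ℂ`, and suppose `∏_i φ_i(p_i^{-k}) = C · ∏_i ψ_i(p_i^{-k})` for every integer
`k ≥ k₀`.  Then there are constants `c_i ≠ 0` with `φ_i = c_i ψ_i` for every `i` and `∏_i c_i = C`.
Proof: expand both products as `∑_e (∏_i coeff) · (∏_i p_i^{e_i})^{-k}` over a box of exponent
vectors `e`; the radii `∏ p_i^{e_i}` are pairwise distinct (`prod_prime_pow_injective`), so the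
coefficient tensors agree, `∏_i a_i(e_i) = C ∏_i b_i(e_i)` on the box
(`eq_zero_of_sum_mul_pow_eq_zero_of_le`); varying one coordinate at a base point where the `b_j`
do not vanish gives `a_i = c_i b_i` coefficientwise. [folklore] -/
theorem prime_separation {ι : Type*} [Fintype ι] [DecidableEq ι] (p : ι → ℕ)
    (hp : ∀ i, (p i).Prime) (hinj : Function.Injective p) (φ ψ : ι → ℂ[X])
    (hφ : ∀ i, φ i ≠ 0) (hψ : ∀ i, ψ i ≠ 0) (C : ℂ) (k₀ : ℕ)
    (h : ∀ k, k₀ ≤ k →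
      ∏ i, (φ i).eval (((p i : ℂ))⁻¹ ^ k) = C * ∏ i, (ψ i).eval (((p i : ℂ))⁻¹ ^ k)) :
    ∃ c : ι → ℂ, (∀ i, c i ≠ 0 ∧ φ i = c i • ψ i) ∧ ∏ i, c i = C := by
  classical
  -- a common strict bound on the degrees
  obtain ⟨N, hN⟩ : ∃ N : ℕ, ∀ i, (φ i).natDegree < N ∧ (ψ i).natDegree < N := by
    refine ⟨(Finset.univ.sup fun i => max (φ i).natDegree (ψ i).natDegree) + 1, fun i => ?_⟩
    have hle : max (φ i).natDegree (ψ i).natDegree ≤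
        Finset.univ.sup fun i => max (φ i).natDegree (ψ i).natDegree :=
      Finset.le_sup (f := fun i => max (φ i).natDegree (ψ i).natDegree) (Finset.mem_univ i)
    constructor <;> omega
  -- the box of exponent vectors, the coefficient tensors and the radii
  set box : Finset (ι → ℕ) := Fintype.piFinset fun _ => Finset.range N with hbox
  set A : (ι → ℕ) → ℂ := fun e => ∏ i, (φ i).coeff (e i) with hA
  set B : (ι → ℕ) → ℂ := fun e => ∏ i, (ψ i).coeff (e i) with hB
  set R : (ι → ℕ) → ℂ := fun e => ∏ i, (p i : ℂ) ^ e i with hR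
  -- expansion of a product of polynomial values over the box
  have hexp : ∀ (χ : ι → ℂ[X]), (∀ i, (χ i).natDegree < N) → ∀ k : ℕ,
      ∏ i, (χ i).eval (((p i : ℂ))⁻¹ ^ k) =
        ∑ e ∈ box, (∏ i, (χ i).coeff (e i)) * (R e)⁻¹ ^ k := by
    intro χ hχ k
    have h1 : ∀ i, (χ i).eval (((p i : ℂ))⁻¹ ^ k) =
        ∑ j ∈ Finset.range N, (χ i).coeff j * (((p i : ℂ))⁻¹ ^ k) ^ j :=
      fun i => Polynomial.eval_eq_sum_range' (hχ i) _
    simp_rw [h1]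
    rw [Finset.prod_univ_sum]
    refine Finset.sum_congr rfl fun e _ => ?_
    rw [Finset.prod_mul_distrib]
    congr 1
    show ∏ x, (((p x : ℂ))⁻¹ ^ k) ^ e x = (∏ i, (p i : ℂ) ^ e i)⁻¹ ^ k
    rw [← Finset.prod_inv_distrib, ← Finset.prod_pow]
    refine Finset.prod_congr rfl fun i _ => ?_
    rw [inv_pow, inv_pow, inv_pow, ← pow_mul, ← pow_mul, mul_comm]
  -- the vanishing sums `∑_e (A e - C B e) (R e)^{-k} = 0`, `k ≥ k₀`
  have hsum : ∀ k, k₀ ≤ k → ∑ e ∈ box, (A e - C * B e) * (R e)⁻¹ ^ k = 0 := by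
    intro k hk
    have h1 := h k hk
    rw [hexp φ (fun i => (hN i).1), hexp ψ (fun i => (hN i).2), Finset.mul_sum] at h1
    simp_rw [sub_mul, Finset.sum_sub_distrib, sub_eq_zero, mul_assoc]
    exact h1
  -- the radii are pairwise distinct and non-zero
  have hRnat : ∀ e : ι → ℕ, R e = ((∏ i, p i ^ e i : ℕ) : ℂ) := by
    intro e
    simp [hR]
  have hRinj : Function.Injective R := by
    intro e e' hee'
    rw [hRnat, hRnat] at hee'
    exact prod_prime_pow_injective p hp hinj (by exact_mod_cast hee')
  have hR0 : ∀ e, R e ≠ 0 := fun e =>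
    Finset.prod_ne_zero_iff.mpr fun i _ => pow_ne_zero _ (by exact_mod_cast (hp i).ne_zero)
  -- independence of the geometric progressions: `A = C B` on the box
  have hAB : ∀ e ∈ box, A e = C * B e := by
    have hz := eq_zero_of_sum_mul_pow_eq_zero_of_le (κ := box) (fun e => (R e)⁻¹)
      (fun e => A e - C * B e) (fun e e' hh => Subtype.ext (hRinj (inv_injective hh)))
      (fun e => inv_ne_zero (hR0 e)) k₀ (fun k hk => by
        rw [Finset.sum_coe_sort box (fun e => (A e - C * B e) * (R e)⁻¹ ^ k)]
        exact hsum k hk)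
    intro e he
    have h1 := congrFun hz ⟨e, he⟩
    simpa [sub_eq_zero] using h1
  -- membership in the box
  have hmem_box : ∀ e : ι → ℕ, (∀ i, e i < N) → e ∈ box := fun e he => by
    rw [hbox, Fintype.mem_piFinset]
    exact fun i => Finset.mem_range.mpr (he i)
  -- `C ≠ 0`: evaluate at the leading exponents of the `φ_i`
  have hC : C ≠ 0 := by
    intro hC0
    have h1 := hAB (fun i => (φ i).natDegree) (hmem_box _ fun i => (hN i).1)
    rw [hC0, zero_mul, hA] at h1
    exact Finset.prod_ne_zero_iff.mpr (fun i _ => Polynomial.leadingCoeff_ne_zero.mpr (hφ i)) h1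
  -- base point: the leading exponents of the `ψ_j`, where no `b_j` vanishes
  set e₀ : ι → ℕ := fun j => (ψ j).natDegree with he₀
  have hb0 : ∀ j, (ψ j).coeff (e₀ j) ≠ 0 := fun j => Polynomial.leadingCoeff_ne_zero.mpr (hψ j)
  -- coordinatewise proportionality
  have hprop : ∀ i, ∃ c : ℂ, c ≠ 0 ∧ ∀ t, (φ i).coeff t = c * (ψ i).coeff t := by
    intro i
    set K : ℂ := ∏ j ∈ Finset.univ.erase i, (φ j).coeff (e₀ j) with hK
    set K' : ℂ := ∏ j ∈ Finset.univ.erase i, (ψ j).coeff (e₀ j) with hK'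
    have hK'0 : K' ≠ 0 := Finset.prod_ne_zero_iff.mpr fun j _ => hb0 j
    -- the tensor identity at `update e₀ i t`
    have hupd : ∀ t < N, (φ i).coeff t * K = C * ((ψ i).coeff t * K') := by
      intro t ht
      have hmem : Function.update e₀ i t ∈ box := by
        refine hmem_box _ fun j => ?_
        rcases eq_or_ne j i with rfl | hji
        · rw [Function.update_self]
          exact ht
        · rw [Function.update_of_ne hji]
          exact (hN j).2
      have h1 := hAB _ hmem
      have hsplit : ∀ (χ : ι → ℂ[X]),
          ∏ j, (χ j).coeff (Function.update e₀ i t j) =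
            (χ i).coeff t * ∏ j ∈ Finset.univ.erase i, (χ j).coeff (e₀ j) := by
        intro χ
        rw [← Finset.mul_prod_erase Finset.univ _ (Finset.mem_univ i), Function.update_self]
        congr 1
        refine Finset.prod_congr rfl fun j hj => ?_
        rw [Function.update_of_ne (Finset.ne_of_mem_erase hj)]
      rw [hA, hB] at h1
      simp only at h1
      rwa [hsplit φ, hsplit ψ] at h1
    -- `K ≠ 0`, for otherwise `ψ_i` would vanish in every degree `< N`
    have hK0 : K ≠ 0 := by
      intro hK0
      have h1 := hupd (e₀ i) (hN i).2
      rw [hK0, mul_zero] at h1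
      have h2 : (ψ i).coeff (e₀ i) * K' = 0 := by
        have := mul_eq_zero.mp h1.symm
        exact this.resolve_left hC
      exact mul_ne_zero (hb0 i) hK'0 h2
    refine ⟨C * K' / K, div_ne_zero (mul_ne_zero hC hK'0) hK0, fun t => ?_⟩
    by_cases ht : t < N
    · have h1 := hupd t ht
      field_simp
      linear_combination h1
    · have hφt : (φ i).coeff t = 0 :=
        Polynomial.coeff_eq_zero_of_natDegree_lt (by have := (hN i).1; omega)
      have hψt : (ψ i).coeff t = 0 :=
        Polynomial.coeff_eq_zero_of_natDegree_lt (by have := (hN i).2; omega)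
      rw [hφt, hψt, mul_zero]
  -- assemble
  choose c hc0 hc using hprop
  refine ⟨c, fun i => ⟨hc0 i, ?_⟩, ?_⟩
  · ext t
    rw [Polynomial.coeff_smul, smul_eq_mul]
    exact hc i t
  · -- compare the tensor identity at `e₀` with the proportionality
    have h1 := hAB e₀ (hmem_box _ fun j => (hN j).2)
    have hBe : B e₀ ≠ 0 := Finset.prod_ne_zero_iff.mpr fun j _ => hb0 j
    have h2 : A e₀ = (∏ i, c i) * B e₀ := by
      rw [hA, hB]
      simp only
      rw [← Finset.prod_mul_distrib]
      exact Finset.prod_congr rfl fun i _ => hc i (e₀ i)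
    rw [h2] at h1
    exact mul_right_cancel₀ hBe h1

end Summit.Langlands.Langlands.Theorems.SkinnerWilesDefectOne.StrongLiftingAllFinite
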